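import Mathlib
import HarnessLib
import Summits.HubbardSuperconductivity.HubbardSuperconductivity.Theorems.KLProgrammeKLRegimeEngineV8E5Witness

/-!
# Route `KLProgramme` — ENGINE child gen 8 (stmt-HubbardSuperconductivity-20437 `KLRegimeEngineV17F2`), SKELETON v2 class #3, PROVING side:
# the E.5 block of the step `n−1 → n` against the SLICE MEASURE from raw step data (the `∃ (C,u), E5ShareStep2 P R C u` ASSEMBLY, part 2 of 3)
# (cell gate-hubbard-kl, seat p5 g9; composes `…E5Witness` §1/§2 with `…E5ShareArith`)

* §3a rescaling utilities for the L1 supplier (line data of `λ·p` from those of `p`: `pullback_normalCovariance_const_mul_symbol`, `rowSum_/colSum_pullback_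
  (const|real)_mul_symbol_le` — factor `‖c‖`/`λ`; `norm_sectorGramF/G_const_mul_symbol` — EXACT factor `√‖c‖`; `…_real_mul_symbol_le` — factor `√λ`);
* §3 **`klE5Block_slice_le_of_stepData_klAniso`** — `…E5Witness` §1 at the step `n−1 → n` (`3 ≤ n`, `K` any frame, `Λ ∈ [Λ_n, Λ_{n−1}]`,
  `λ := Λ_{n−1} − Λ_n`, family level `n−2`) composed with `klE5_share_arith`: sizes `α ≤ λ·(Cα·ε⁻¹·16^n/e₀²)`, `δ ≤ Cδ·e₀·8^{−n}`, `A ≤ CA·ε²·X·8^n` give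
  `‖klE5Block‖·(Λ_{n−1} − Λ_n) ≤ (4!·13⁴·1680·2⁹·88²·3·(16·Cα)·Cδ²·CA)·(X·e₀)·2^{−n}` — every power of `ε` cancelled ((E5-VOL) cured end to end);
  **`klE5Block_slice_le_of_stepData_trivial`** — the twin for the first steps (`1 ≤ n`, trivial sectorisation), weakened to the same constant;
* §4 **`klE5BlockR1_slice_le_of_stepData`** — §3 at `κ := klE5Kappa`, `V := klE5Input`, `X := (Klam·U)³`: LITERALLY the shape of `E5ShareStep2`'s
  conclusion (`‖klE5BlockR1 … K (n−1) Λ Qm x y‖·(Λ_{n−1} − Λ_n) ≤ C·(Klam·U)³·2^{−n}`, `C = (4!·13⁴·1680·2⁹·88²·3·(16·Cα)·Cδ²·CA)·e₀`) at any frame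
  `K` (the step Prop reads `K := klFlowFrameU … n`).

Pure composition; no definitions, no named facts, nothing about the model's sizes is asserted; nothing asserts superconductivity.
-/

noncomputable section

namespace Summit.HubbardSuperconductivity.HubbardSuperconductivity.Theorems.KLRegimeSplit

set_option linter.dupNamespace false -- summit = problem name (single-conjunct summit), D-0017

open Real Finset Literature.MathematicalPhysics.QuantumLattice Literature.Probability.LatticeModels GrassmannAlgebra Matrix
open Literature.MathematicalPhysics.QuantumLattice.FermiRG
open Summit.HubbardSuperconductivity.HubbardSuperconductivity.Theorems.KLProgrammeLegKernels
open Summit.HubbardSuperconductivity.HubbardSuperconductivity.Theorems.KLRegimeWick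
open Summit.HubbardSuperconductivity.HubbardSuperconductivity.Theorems.EngineV8
open Summit.HubbardSuperconductivity.HubbardSuperconductivity.Theorems.TwoPointAssembly
open Summit.HubbardSuperconductivity.HubbardSuperconductivity.Theorems.TorusFourierL2
open Summit.HubbardSuperconductivity.HubbardSuperconductivity.Theorems.DispersionFlow

/-! ## §3a Rescaling utilities: line data of a RESCALED symbol from those of the symbol (for the L1 supplier) -/

section Rescale

variable {L M N : ℕ} [NeZero L] (β : ℝ) (F : Fin N → FreqMomentum L M → ℂ) (c : ℂ) (p : FreqMomentum L M × Fin 2 → ℂ)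

omit [NeZero L] in
/-- Scaling the symbol scales the normal covariance (matrix form of `normalCovariance_smul_symbol`). [folklore] -/
theorem normalCovariance_const_mul_symbol : normalCovariance L M (fun ks => c * p ks) = c • normalCovariance L M p := by
  ext X Y
  rw [normalCovariance_smul_symbol (fun _ => c), Matrix.smul_apply, smul_eq_mul]

/-- **The pulled-back line of a rescaled symbol**: `S(F)ᵀ·N(c·p)·S(F) = c • (S(F)ᵀ·N(p)·S(F))`. [folklore] -/
theorem pullback_normalCovariance_const_mul_symbol :
    (sectorSubMatrix L M β F).transpose * normalCovariance L M (fun ks => c * p ks) * sectorSubMatrix L M β F =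
      c • ((sectorSubMatrix L M β F).transpose * normalCovariance L M p * sectorSubMatrix L M β F) := by
  rw [normalCovariance_const_mul_symbol, Matrix.mul_smul, Matrix.smul_mul]

/-- Row sums of the pulled-back line of a rescaled symbol: `≤ ‖c‖·α` from `≤ α`. [folklore] -/
theorem rowSum_pullback_const_mul_symbol_le {α : ℝ}
    (hrow : ∀ X, ∑ Y, ‖((sectorSubMatrix L M β F).transpose * normalCovariance L M p * sectorSubMatrix L M β F) X Y‖ ≤ α)
    (X : SpaceTimeIdx L M × SectorLeg N) :
    ∑ Y, ‖((sectorSubMatrix L M β F).transpose * normalCovariance L M (fun ks => c * p ks) * sectorSubMatrix L M β F) X Y‖ ≤ ‖c‖ * α := by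
  rw [pullback_normalCovariance_const_mul_symbol]
  simp_rw [Matrix.smul_apply, smul_eq_mul, norm_mul, ← mul_sum]
  exact mul_le_mul_of_nonneg_left (hrow X) (norm_nonneg c)

/-- Column sums of the pulled-back line of a rescaled symbol: `≤ ‖c‖·α` from `≤ α`. [folklore] -/
theorem colSum_pullback_const_mul_symbol_le {α : ℝ}
    (hcol : ∀ Y, ∑ X, ‖((sectorSubMatrix L M β F).transpose * normalCovariance L M p * sectorSubMatrix L M β F) X Y‖ ≤ α)
    (Y : SpaceTimeIdx L M × SectorLeg N) :
    ∑ X, ‖((sectorSubMatrix L M β F).transpose * normalCovariance L M (fun ks => c * p ks) * sectorSubMatrix L M β F) X Y‖ ≤ ‖c‖ * α := by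
  rw [pullback_normalCovariance_const_mul_symbol]
  simp_rw [Matrix.smul_apply, smul_eq_mul, norm_mul, ← mul_sum]
  exact mul_le_mul_of_nonneg_left (hcol Y) (norm_nonneg c)

/-- **The left Gram vector of a rescaled symbol**: `‖F_Y(c·p)‖ = √‖c‖·‖F_Y(p)‖`. [cite: BenfattoGiulianiMastropietro2006, §2.8 (2.80)] -/
theorem norm_sectorGramF_const_mul_symbol (Y : SpaceTimeIdx L M × SectorLeg N) :
    ‖sectorGramF L M β F (fun ks => c * p ks) Y‖ = Real.sqrt ‖c‖ * ‖sectorGramF L M β F p Y‖ := by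
  have h1 : ‖sectorGramF L M β F (fun ks => c * p ks) Y‖ ^ 2 = (Real.sqrt ‖c‖ * ‖sectorGramF L M β F p Y‖) ^ 2 := by
    rw [mul_pow, Real.sq_sqrt (norm_nonneg c), norm_sq_sectorGramF, norm_sq_sectorGramF, mul_sum]
    exact sum_congr rfl fun k _ => by rw [norm_mul]; ring
  exact (pow_left_inj₀ (norm_nonneg _) (by positivity) two_ne_zero).1 h1

/-- **The right Gram vector of a rescaled symbol**: `‖G_{Y′}(c·p)‖ = √‖c‖·‖G_{Y′}(p)‖`. [cite: BenfattoGiulianiMastropietro2006, §2.8 (2.80)] -/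
theorem norm_sectorGramG_const_mul_symbol (Y' : SpaceTimeIdx L M × SectorLeg N) :
    ‖sectorGramG L M β F (fun ks => c * p ks) Y'‖ = Real.sqrt ‖c‖ * ‖sectorGramG L M β F p Y'‖ := by
  have h1 : ‖sectorGramG L M β F (fun ks => c * p ks) Y'‖ ^ 2 = (Real.sqrt ‖c‖ * ‖sectorGramG L M β F p Y'‖) ^ 2 := by
    rw [mul_pow, Real.sq_sqrt (norm_nonneg c), norm_sq_sectorGramG, norm_sq_sectorGramG, mul_sum]
    exact sum_congr rfl fun k _ => by rw [norm_mul]; ring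
  exact (pow_left_inj₀ (norm_nonneg _) (by positivity) two_ne_zero).1 h1

/-- For a real scaling `0 ≤ λ`: `‖F_Y(λ·p)‖ ≤ √λ·κ` from `‖F_Y(p)‖ ≤ κ`. [folklore] -/
theorem norm_sectorGramF_real_mul_symbol_le {lam κ : ℝ} (hlam : 0 ≤ lam) (Y : SpaceTimeIdx L M × SectorLeg N)
    (h : ‖sectorGramF L M β F p Y‖ ≤ κ) : ‖sectorGramF L M β F (fun ks => (lam : ℂ) * p ks) Y‖ ≤ Real.sqrt lam * κ := by
  rw [norm_sectorGramF_const_mul_symbol, Complex.norm_real, Real.norm_of_nonneg hlam]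
  exact mul_le_mul_of_nonneg_left h (Real.sqrt_nonneg _)

/-- For a real scaling `0 ≤ λ`: `‖G_{Y′}(λ·p)‖ ≤ √λ·κ` from `‖G_{Y′}(p)‖ ≤ κ`. [folklore] -/
theorem norm_sectorGramG_real_mul_symbol_le {lam κ : ℝ} (hlam : 0 ≤ lam) (Y' : SpaceTimeIdx L M × SectorLeg N)
    (h : ‖sectorGramG L M β F p Y'‖ ≤ κ) : ‖sectorGramG L M β F (fun ks => (lam : ℂ) * p ks) Y'‖ ≤ Real.sqrt lam * κ := by
  rw [norm_sectorGramG_const_mul_symbol, Complex.norm_real, Real.norm_of_nonneg hlam]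
  exact mul_le_mul_of_nonneg_left h (Real.sqrt_nonneg _)

/-- For a real scaling `0 ≤ λ`: row sums `≤ λ·α` from `≤ α`. [folklore] -/
theorem rowSum_pullback_real_mul_symbol_le {lam α : ℝ} (hlam : 0 ≤ lam)
    (hrow : ∀ X, ∑ Y, ‖((sectorSubMatrix L M β F).transpose * normalCovariance L M p * sectorSubMatrix L M β F) X Y‖ ≤ α)
    (X : SpaceTimeIdx L M × SectorLeg N) :
    ∑ Y, ‖((sectorSubMatrix L M β F).transpose * normalCovariance L M (fun ks => (lam : ℂ) * p ks) * sectorSubMatrix L M β F) X Y‖ ≤ lam * α := by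
  have h := rowSum_pullback_const_mul_symbol_le β F (lam : ℂ) p hrow X
  rwa [Complex.norm_real, Real.norm_of_nonneg hlam] at h

/-- For a real scaling `0 ≤ λ`: column sums `≤ λ·α` from `≤ α`. [folklore] -/
theorem colSum_pullback_real_mul_symbol_le {lam α : ℝ} (hlam : 0 ≤ lam)
    (hcol : ∀ Y, ∑ X, ‖((sectorSubMatrix L M β F).transpose * normalCovariance L M p * sectorSubMatrix L M β F) X Y‖ ≤ α)
    (Y : SpaceTimeIdx L M × SectorLeg N) :
    ∑ X, ‖((sectorSubMatrix L M β F).transpose * normalCovariance L M (fun ks => (lam : ℂ) * p ks) * sectorSubMatrix L M β F) X Y‖ ≤ lam * α := by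
  have h := colSum_pullback_const_mul_symbol_le β F (lam : ℂ) p hcol Y
  rwa [Complex.norm_real, Real.norm_of_nonneg hlam] at h

end Rescale

/-! ## §3 The step `n−1 → n`: the slice measure and the scale arithmetic (`klE5_share_arith`) -/

section Slice

variable {L M : ℕ} [NeZero L] [NeZero M] (β μ : ℝ) (K : TrigPolyC4v) (κ : FreqMomentum L M × Fin 2 → ℂ)
  (V : HubbardGrassmann L M) (Λ : ℝ) (Qm : TorusSite 2 L) (x y : TorusSite 2 L × MatsubaraIdx M)

/-- **The E.5 block of the step `n−1 → n` against the slice measure, thin/fat pair of record** (`3 ≤ n`, any frame `K`, dressing `κ`, input `V`;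
`Λ ∈ [Λ_n, Λ_{n−1}]`, family level `n−2`, line `0` rescaled by `λ := Λ_{n−1} − Λ_n`): §1's raw data with the sizes of record — `α ≤ λ·(Cα·ε⁻¹·16^n/e₀²)`
(dressed slice derivative, symbol `≍ Λ⁻²` on the shell), `δ ≤ Cδ·e₀·8^{−n}` (soft line), `A ≤ CA·ε²·X·8^n` (levelled vertex part) — give, by `klE5_share_arith`,
`‖klE5Block … (n−1) Λ Qm x y‖·(Λ_{n−1} − Λ_n) ≤ (4!·13⁴·1680·2⁹·88²·3·(16·Cα)·Cδ²·CA)·(X·e₀)·2^{−n}`: every power of `ε` cancelled, (L, M)-uniform.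
[cite: BenfattoGiulianiMastropietro2006, §2.8 (2.80)] -/
theorem klE5Block_slice_le_of_stepData_klAniso (hβ : 0 < β) {n : ℕ} (hn : 3 ≤ n) (hΛ : Λ ∈ Set.Icc (klScale klE0 n) (klScale klE0 (n - 1)))
    {α κ₀ δ κ₁ : ℝ} (hα : 0 ≤ α) (hκ₀ : 0 ≤ κ₀) (hδ : 0 ≤ δ) (hκ₁ : 0 ≤ κ₁)
    (hrow : ∀ X, ∑ Y, ‖((sectorSubMatrix L M β (bgmFatMultiplier L M klE0 β (nambuXiCT L μ K) (n - 2))).transpose *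
        normalCovariance L M (fun ks => ((klScale klE0 (n - 1) - klScale klE0 n : ℝ) : ℂ) * klE5DerivLineSym L M β μ K (n - 1) κ Λ ks) *
        sectorSubMatrix L M β (bgmFatMultiplier L M klE0 β (nambuXiCT L μ K) (n - 2))) X Y‖ ≤ α)
    (hcol : ∀ Y, ∑ X, ‖((sectorSubMatrix L M β (bgmFatMultiplier L M klE0 β (nambuXiCT L μ K) (n - 2))).transpose *
        normalCovariance L M (fun ks => ((klScale klE0 (n - 1) - klScale klE0 n : ℝ) : ℂ) * klE5DerivLineSym L M β μ K (n - 1) κ Λ ks) *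
        sectorSubMatrix L M β (bgmFatMultiplier L M klE0 β (nambuXiCT L μ K) (n - 2))) X Y‖ ≤ α)
    (hκF₀ : ∀ Y : SpaceTimeIdx L M × SectorLeg (sectorCount (n - 2)), Y.2.2 = 0 →
      ‖sectorGramF L M β (bgmFatMultiplier L M klE0 β (nambuXiCT L μ K) (n - 2))
        (fun ks => ((klScale klE0 (n - 1) - klScale klE0 n : ℝ) : ℂ) * klE5DerivLineSym L M β μ K (n - 1) κ Λ ks) Y‖ ≤ κ₀)
    (hκG₀ : ∀ Y : SpaceTimeIdx L M × SectorLeg (sectorCount (n - 2)), Y.2.2 = 1 →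
      ‖sectorGramG L M β (bgmFatMultiplier L M klE0 β (nambuXiCT L μ K) (n - 2))
        (fun ks => ((klScale klE0 (n - 1) - klScale klE0 n : ℝ) : ℂ) * klE5DerivLineSym L M β μ K (n - 1) κ Λ ks) Y‖ ≤ κ₀)
    (hent : ∀ X Y, ‖((sectorSubMatrix L M β (bgmFatMultiplier L M klE0 β (nambuXiCT L μ K) (n - 2))).transpose *
        normalCovariance L M (klE5SoftLineSym L M β μ K (n - 1) κ Λ) *
        sectorSubMatrix L M β (bgmFatMultiplier L M klE0 β (nambuXiCT L μ K) (n - 2))) X Y‖ ≤ δ)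
    (hκF₁ : ∀ Y : SpaceTimeIdx L M × SectorLeg (sectorCount (n - 2)), Y.2.2 = 0 →
      ‖sectorGramF L M β (bgmFatMultiplier L M klE0 β (nambuXiCT L μ K) (n - 2)) (klE5SoftLineSym L M β μ K (n - 1) κ Λ) Y‖ ≤ κ₁)
    (hκG₁ : ∀ Y : SpaceTimeIdx L M × SectorLeg (sectorCount (n - 2)), Y.2.2 = 1 →
      ‖sectorGramG L M β (bgmFatMultiplier L M klE0 β (nambuXiCT L μ K) (n - 2)) (klE5SoftLineSym L M β μ K (n - 1) κ Λ) Y‖ ≤ κ₁)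
    (Nf Ne : ℕ → ℕ → ℝ) (hNe0 : ∀ k q, 0 ≤ Ne k q)
    (hNf : ∀ k ∈ Icc 3 (Fintype.card (HubbardFieldIdx L M × Fin 2) + 2), ∀ q ≤ 4, ∀ σ : Fin q → SectorLeg (sectorCount (n - 2) + 4),
      hubbardSectorKernelNorm L M β (pointAugment (klAnisoFamily L M β μ K klE0 (n - 2)) (klE5ExtMomenta Qm x y)) (prescribedTuples univ
        (Fin.append (fun _ : Fin k => (none : Option (SectorLeg (sectorCount (n - 2) + 4)))) (fun j => some (σ j))))
        (klE5Carrier L M β μ K (n - 1) κ V Λ) ≤ Nf k q)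
    (hNe : ∀ k ∈ Icc 3 (Fintype.card (HubbardFieldIdx L M × Fin 2) + 2), ∀ q ≤ 4,
      ∀ (τ : Fin 3 → SectorLeg (sectorCount (n - 2) + 4)) (σ : Fin q → SectorLeg (sectorCount (n - 2) + 4)),
      hubbardSectorKernelNorm L M β (pointAugment (klAnisoFamily L M β μ K klE0 (n - 2)) (klE5ExtMomenta Qm x y)) (prescribedTuples univ
        (Fin.append (fun i : Fin k => if h : (i : ℕ) < 3 then some (τ ⟨i, h⟩) else none) (fun j => some (σ j))))
        (klE5Carrier L M β μ K (n - 1) κ V Λ) ≤ Ne k q)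
    {x' A : ℝ} (hx0 : 0 ≤ x') (hx1 : x' ≤ 1 / 2) (hA : 0 ≤ A)
    (henv : ∀ q ∈ Icc 1 4, ∀ k ∈ Icc 3 (Fintype.card (HubbardFieldIdx L M × Fin 2) + 2),
      (κ₀ ^ 2 + κ₁ ^ 2) ^ (k - 3) * ((imagTimeWeight β M * Nf k q) * (imagTimeWeight β M * Ne k (4 - q))) ≤ x' ^ (k - 3) * A)
    {Cα Cδ CA X : ℝ}
    (hαs : α ≤ (klScale klE0 (n - 1) - klScale klE0 n) * (Cα * (imagTimeWeight β M)⁻¹ * (16 : ℝ) ^ n / klE0 ^ 2))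
    (hδs : δ ≤ Cδ * klE0 * ((8 : ℝ) ^ n)⁻¹) (hAs : A ≤ CA * imagTimeWeight β M ^ 2 * X * (8 : ℝ) ^ n) :
    ‖klE5Block L M β μ K (n - 1) κ V Λ Qm x y‖ * (klScale klE0 (n - 1) - klScale klE0 n) ≤
      (((4 : ℕ).factorial : ℝ) * 13 ^ 4 * (1680 * 2 ^ 9) * 88 ^ 2 * 3 * (16 * Cα) * Cδ ^ 2 * CA) * (X * klE0) * ((2 : ℝ) ^ n)⁻¹ := by
  have hε : 0 < imagTimeWeight β M := by
    have hM : (0 : ℝ) < (M : ℝ) := by exact_mod_cast Nat.pos_of_ne_zero (NeZero.ne M)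
    unfold imagTimeWeight; positivity
  have he₀ : (0 : ℝ) < klE0 := by norm_num [klE0]
  have hslice := klScale_pred_sub_eq klE0 (show 1 ≤ n by omega)
  have hlam : 0 < klScale klE0 (n - 1) - klScale klE0 n := by rw [hslice]; positivity
  have hΛ0 : 0 < Λ := lt_of_lt_of_le (by unfold klScale; positivity) hΛ.1
  have hB := norm_klE5Block_le_of_stepData_klAniso β μ K (n - 1) κ V Λ Qm x y hβ (mf := n - 2) (by omega) (by omega) hΛ0 hΛ.2 hlam
    hα hκ₀ hδ hκ₁ hrow hcol hκF₀ hκG₀ hent hκF₁ hκG₁ Nf Ne hNe0 hNf hNe hx0 hx1 hA henv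
  -- present the bound in the shape of `klE5_share_arith` with `α' := 16·λ⁻¹·α`
  have hB' : ‖klE5Block L M β μ K (n - 1) κ V Λ Qm x y‖ ≤ ((4 : ℕ).factorial : ℝ) * 13 ^ 4 * (imagTimeWeight β M)⁻¹ *
      ((1680 * 2 ^ 9) * ((16 * ((klScale klE0 (n - 1) - klScale klE0 n)⁻¹ * α)) * (88 * δ) ^ 2 * A)) := by
    refine hB.trans (le_of_eq ?_); ring
  have hα' : 16 * ((klScale klE0 (n - 1) - klScale klE0 n)⁻¹ * α) ≤ (16 * Cα) * (imagTimeWeight β M)⁻¹ * (16 : ℝ) ^ n / klE0 ^ 2 := by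
    have h1 : (klScale klE0 (n - 1) - klScale klE0 n)⁻¹ * α ≤ Cα * (imagTimeWeight β M)⁻¹ * (16 : ℝ) ^ n / klE0 ^ 2 := by
      rw [inv_mul_le_iff₀ hlam]; exact hαs
    have h2 : (16 * Cα) * (imagTimeWeight β M)⁻¹ * (16 : ℝ) ^ n / klE0 ^ 2 = 16 * (Cα * (imagTimeWeight β M)⁻¹ * (16 : ℝ) ^ n / klE0 ^ 2) := by ring
    rw [h2]; exact mul_le_mul_of_nonneg_left h1 (by norm_num)
  exact klE5_share_arith hε he₀ (show 1 ≤ n by omega) le_rfl (by positivity) hα' hδ hδs hA hAs hB'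

/-- **The twin against the slice measure through the TRIVIAL sectorisation** (`1 ≤ n`, any frame, dressing, input; `Λ` any cutoff; line `0` rescaled by
`λ := Λ_{n−1} − Λ_n`): §2's raw data with sizes in the same currency give the same target with `13⁴·88²` replaced by `1·4²` — stated here WEAKENED to the
very same constant as `klE5Block_slice_le_of_stepData_klAniso`, so that one share `C` serves every step. [cite: BenfattoGiulianiMastropietro2006, §2.8 (2.80)] -/
theorem klE5Block_slice_le_of_stepData_trivial (hβ : 0 < β) {n : ℕ} (hn : 1 ≤ n)
    {α κ₀ δ κ₁ : ℝ} (hα : 0 ≤ α) (hδ : 0 ≤ δ)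
    (hrow : ∀ X, ∑ Y, ‖((sectorSubMatrix L M β (trivialMultiplier L M)).transpose *
        normalCovariance L M (fun ks => ((klScale klE0 (n - 1) - klScale klE0 n : ℝ) : ℂ) * klE5DerivLineSym L M β μ K (n - 1) κ Λ ks) *
        sectorSubMatrix L M β (trivialMultiplier L M)) X Y‖ ≤ α)
    (hcol : ∀ Y, ∑ X, ‖((sectorSubMatrix L M β (trivialMultiplier L M)).transpose *
        normalCovariance L M (fun ks => ((klScale klE0 (n - 1) - klScale klE0 n : ℝ) : ℂ) * klE5DerivLineSym L M β μ K (n - 1) κ Λ ks) *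
        sectorSubMatrix L M β (trivialMultiplier L M)) X Y‖ ≤ α)
    (hκF₀ : ∀ Y : SpaceTimeIdx L M × SectorLeg 1, Y.2.2 = 0 → ‖sectorGramF L M β (trivialMultiplier L M)
        (fun ks => ((klScale klE0 (n - 1) - klScale klE0 n : ℝ) : ℂ) * klE5DerivLineSym L M β μ K (n - 1) κ Λ ks) Y‖ ≤ κ₀)
    (hκG₀ : ∀ Y : SpaceTimeIdx L M × SectorLeg 1, Y.2.2 = 1 → ‖sectorGramG L M β (trivialMultiplier L M)
        (fun ks => ((klScale klE0 (n - 1) - klScale klE0 n : ℝ) : ℂ) * klE5DerivLineSym L M β μ K (n - 1) κ Λ ks) Y‖ ≤ κ₀)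
    (hent : ∀ X Y, ‖((sectorSubMatrix L M β (trivialMultiplier L M)).transpose *
        normalCovariance L M (klE5SoftLineSym L M β μ K (n - 1) κ Λ) * sectorSubMatrix L M β (trivialMultiplier L M)) X Y‖ ≤ δ)
    (hκF₁ : ∀ Y : SpaceTimeIdx L M × SectorLeg 1, Y.2.2 = 0 →
      ‖sectorGramF L M β (trivialMultiplier L M) (klE5SoftLineSym L M β μ K (n - 1) κ Λ) Y‖ ≤ κ₁)
    (hκG₁ : ∀ Y : SpaceTimeIdx L M × SectorLeg 1, Y.2.2 = 1 →
      ‖sectorGramG L M β (trivialMultiplier L M) (klE5SoftLineSym L M β μ K (n - 1) κ Λ) Y‖ ≤ κ₁)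
    (Nf Ne : ℕ → ℕ → ℝ) (hNe0 : ∀ k q, 0 ≤ Ne k q)
    (hNf : ∀ k ∈ Icc 3 (Fintype.card (HubbardFieldIdx L M × Fin 2) + 2), ∀ q ≤ 4, ∀ σ : Fin q → SectorLeg 1,
      hubbardSectorKernelNorm L M β (trivialMultiplier L M) (prescribedTuples univ
        (Fin.append (fun _ : Fin k => (none : Option (SectorLeg 1))) (fun j => some (σ j)))) (klE5Carrier L M β μ K (n - 1) κ V Λ) ≤ Nf k q)
    (hNe : ∀ k ∈ Icc 3 (Fintype.card (HubbardFieldIdx L M × Fin 2) + 2), ∀ q ≤ 4, ∀ (τ : Fin 3 → SectorLeg 1) (σ : Fin q → SectorLeg 1),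
      hubbardSectorKernelNorm L M β (trivialMultiplier L M) (prescribedTuples univ
        (Fin.append (fun i : Fin k => if h : (i : ℕ) < 3 then some (τ ⟨i, h⟩) else none) (fun j => some (σ j))))
        (klE5Carrier L M β μ K (n - 1) κ V Λ) ≤ Ne k q)
    {x' A : ℝ} (hx0 : 0 ≤ x') (hx1 : x' ≤ 1 / 2) (hA : 0 ≤ A)
    (henv : ∀ q ∈ Icc 1 4, ∀ k ∈ Icc 3 (Fintype.card (HubbardFieldIdx L M × Fin 2) + 2),
      (κ₀ ^ 2 + κ₁ ^ 2) ^ (k - 3) * ((imagTimeWeight β M * Nf k q) * (imagTimeWeight β M * Ne k (4 - q))) ≤ x' ^ (k - 3) * A)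
    {Cα Cδ CA X : ℝ}
    (hαs : α ≤ (klScale klE0 (n - 1) - klScale klE0 n) * (Cα * (imagTimeWeight β M)⁻¹ * (16 : ℝ) ^ n / klE0 ^ 2))
    (hδs : δ ≤ Cδ * klE0 * ((8 : ℝ) ^ n)⁻¹) (hAs : A ≤ CA * imagTimeWeight β M ^ 2 * X * (8 : ℝ) ^ n) :
    ‖klE5Block L M β μ K (n - 1) κ V Λ Qm x y‖ * (klScale klE0 (n - 1) - klScale klE0 n) ≤
      (((4 : ℕ).factorial : ℝ) * 13 ^ 4 * (1680 * 2 ^ 9) * 88 ^ 2 * 3 * (16 * Cα) * Cδ ^ 2 * CA) * (X * klE0) * ((2 : ℝ) ^ n)⁻¹ := by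
  have hε : 0 < imagTimeWeight β M := by
    have hM : (0 : ℝ) < (M : ℝ) := by exact_mod_cast Nat.pos_of_ne_zero (NeZero.ne M)
    unfold imagTimeWeight; positivity
  have he₀ : (0 : ℝ) < klE0 := by norm_num [klE0]
  have hslice := klScale_pred_sub_eq klE0 hn
  have hlam : 0 < klScale klE0 (n - 1) - klScale klE0 n := by rw [hslice]; positivity
  have hB := norm_klE5Block_le_of_stepData_trivial β μ K (n - 1) κ V Λ Qm x y hβ hlam
    hα hδ hrow hcol hκF₀ hκG₀ hent hκF₁ hκG₁ Nf Ne hNe0 hNf hNe hx0 hx1 hA henv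
  -- weaken `1·(4δ)²` to `13⁴·(88δ)²` and present in the shape of `klE5_share_arith` with `α' := 16·λ⁻¹·α`
  have hB' : ‖klE5Block L M β μ K (n - 1) κ V Λ Qm x y‖ ≤ ((4 : ℕ).factorial : ℝ) * 13 ^ 4 * (imagTimeWeight β M)⁻¹ *
      ((1680 * 2 ^ 9) * ((16 * ((klScale klE0 (n - 1) - klScale klE0 n)⁻¹ * α)) * (88 * δ) ^ 2 * A)) := by
    refine hB.trans ?_
    have h0 : 0 ≤ ((4 : ℕ).factorial : ℝ) * (imagTimeWeight β M)⁻¹ * ((1680 * 2 ^ 9) * ((16 * ((klScale klE0 (n - 1) - klScale klE0 n)⁻¹ * α)) * A)) := by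
      positivity
    have h1 : ((4 : ℕ).factorial : ℝ) * (imagTimeWeight β M)⁻¹ * (16 * ((klScale klE0 (n - 1) - klScale klE0 n)⁻¹ * ((1680 * 2 ^ 9) * (α * (4 * δ) ^ 2 * A)))) =
        ((4 : ℕ).factorial : ℝ) * (imagTimeWeight β M)⁻¹ * ((1680 * 2 ^ 9) * ((16 * ((klScale klE0 (n - 1) - klScale klE0 n)⁻¹ * α)) * A)) * (4 ^ 2 * δ ^ 2) := by
      ring
    have h2 : ((4 : ℕ).factorial : ℝ) * 13 ^ 4 * (imagTimeWeight β M)⁻¹ *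
        ((1680 * 2 ^ 9) * ((16 * ((klScale klE0 (n - 1) - klScale klE0 n)⁻¹ * α)) * (88 * δ) ^ 2 * A)) =
        ((4 : ℕ).factorial : ℝ) * (imagTimeWeight β M)⁻¹ * ((1680 * 2 ^ 9) * ((16 * ((klScale klE0 (n - 1) - klScale klE0 n)⁻¹ * α)) * A)) *
          (13 ^ 4 * 88 ^ 2 * δ ^ 2) := by
      ring
    rw [h1, h2]
    exact mul_le_mul_of_nonneg_left (by nlinarith [sq_nonneg δ]) h0
  have hα' : 16 * ((klScale klE0 (n - 1) - klScale klE0 n)⁻¹ * α) ≤ (16 * Cα) * (imagTimeWeight β M)⁻¹ * (16 : ℝ) ^ n / klE0 ^ 2 := by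
    have h1 : (klScale klE0 (n - 1) - klScale klE0 n)⁻¹ * α ≤ Cα * (imagTimeWeight β M)⁻¹ * (16 : ℝ) ^ n / klE0 ^ 2 := by
      rw [inv_mul_le_iff₀ hlam]; exact hαs
    have h2 : (16 * Cα) * (imagTimeWeight β M)⁻¹ * (16 : ℝ) ^ n / klE0 ^ 2 = 16 * (Cα * (imagTimeWeight β M)⁻¹ * (16 : ℝ) ^ n / klE0 ^ 2) := by ring
    rw [h2]; exact mul_le_mul_of_nonneg_left h1 (by norm_num)
  exact klE5_share_arith hε he₀ hn le_rfl (by positivity) hα' hδ hδs hA hAs hB'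

end Slice

/-! ## §4 The (R1′) block of record: `κ := klE5Kappa`, `V := klE5Input`, `X := (P.Klam·U)³` — the literal shape of `E5ShareStep2`'s conclusion -/

section R1

variable {L M : ℕ} [NeZero L] [NeZero M] (β U μ : ℝ) (K : TrigPolyC4v) (Λ : ℝ) (Qm : TorusSite 2 L) (x y : TorusSite 2 L × MatsubaraIdx M)

/-- **The (R1′) E.5 block of the step `n−1 → n` in the literal currency of `E5ShareStep2`** (`3 ≤ n`, any frame `K` — at `K := klFlowFrameU … n` this is the step
Prop's conclusion): §3 at `κ := klE5Kappa … K (n−1)`, `V := klE5Input … K (n−1)`, `X := (Klam·U)³` gives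
`‖klE5BlockR1 … K (n−1) Λ Qm x y‖·(Λ_{n−1} − Λ_n) ≤ C·(Klam·U)³·2^{−n}` with `C = (4!·13⁴·1680·2⁹·88²·3·(16·Cα)·Cδ²·CA)·e₀`.
[cite: BenfattoGiulianiMastropietro2006, §2.8 (2.80)] -/
theorem klE5BlockR1_slice_le_of_stepData (hβ : 0 < β) {n : ℕ} (hn : 3 ≤ n) (hΛ : Λ ∈ Set.Icc (klScale klE0 n) (klScale klE0 (n - 1)))
    {α κ₀ δ κ₁ : ℝ} (hα : 0 ≤ α) (hκ₀ : 0 ≤ κ₀) (hδ : 0 ≤ δ) (hκ₁ : 0 ≤ κ₁)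
    (hrow : ∀ X, ∑ Y, ‖((sectorSubMatrix L M β (bgmFatMultiplier L M klE0 β (nambuXiCT L μ K) (n - 2))).transpose *
        normalCovariance L M (fun ks => ((klScale klE0 (n - 1) - klScale klE0 n : ℝ) : ℂ) *
          klE5DerivLineSym L M β μ K (n - 1) (klE5Kappa L M β U μ K (n - 1)) Λ ks) *
        sectorSubMatrix L M β (bgmFatMultiplier L M klE0 β (nambuXiCT L μ K) (n - 2))) X Y‖ ≤ α)
    (hcol : ∀ Y, ∑ X, ‖((sectorSubMatrix L M β (bgmFatMultiplier L M klE0 β (nambuXiCT L μ K) (n - 2))).transpose *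
        normalCovariance L M (fun ks => ((klScale klE0 (n - 1) - klScale klE0 n : ℝ) : ℂ) *
          klE5DerivLineSym L M β μ K (n - 1) (klE5Kappa L M β U μ K (n - 1)) Λ ks) *
        sectorSubMatrix L M β (bgmFatMultiplier L M klE0 β (nambuXiCT L μ K) (n - 2))) X Y‖ ≤ α)
    (hκF₀ : ∀ Y : SpaceTimeIdx L M × SectorLeg (sectorCount (n - 2)), Y.2.2 = 0 →
      ‖sectorGramF L M β (bgmFatMultiplier L M klE0 β (nambuXiCT L μ K) (n - 2)) (fun ks => ((klScale klE0 (n - 1) - klScale klE0 n : ℝ) : ℂ) *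
          klE5DerivLineSym L M β μ K (n - 1) (klE5Kappa L M β U μ K (n - 1)) Λ ks) Y‖ ≤ κ₀)
    (hκG₀ : ∀ Y : SpaceTimeIdx L M × SectorLeg (sectorCount (n - 2)), Y.2.2 = 1 →
      ‖sectorGramG L M β (bgmFatMultiplier L M klE0 β (nambuXiCT L μ K) (n - 2)) (fun ks => ((klScale klE0 (n - 1) - klScale klE0 n : ℝ) : ℂ) *
          klE5DerivLineSym L M β μ K (n - 1) (klE5Kappa L M β U μ K (n - 1)) Λ ks) Y‖ ≤ κ₀)
    (hent : ∀ X Y, ‖((sectorSubMatrix L M β (bgmFatMultiplier L M klE0 β (nambuXiCT L μ K) (n - 2))).transpose *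
        normalCovariance L M (klE5SoftLineSym L M β μ K (n - 1) (klE5Kappa L M β U μ K (n - 1)) Λ) *
        sectorSubMatrix L M β (bgmFatMultiplier L M klE0 β (nambuXiCT L μ K) (n - 2))) X Y‖ ≤ δ)
    (hκF₁ : ∀ Y : SpaceTimeIdx L M × SectorLeg (sectorCount (n - 2)), Y.2.2 = 0 → ‖sectorGramF L M β (bgmFatMultiplier L M klE0 β (nambuXiCT L μ K) (n - 2))
        (klE5SoftLineSym L M β μ K (n - 1) (klE5Kappa L M β U μ K (n - 1)) Λ) Y‖ ≤ κ₁)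
    (hκG₁ : ∀ Y : SpaceTimeIdx L M × SectorLeg (sectorCount (n - 2)), Y.2.2 = 1 → ‖sectorGramG L M β (bgmFatMultiplier L M klE0 β (nambuXiCT L μ K) (n - 2))
        (klE5SoftLineSym L M β μ K (n - 1) (klE5Kappa L M β U μ K (n - 1)) Λ) Y‖ ≤ κ₁)
    (Nf Ne : ℕ → ℕ → ℝ) (hNe0 : ∀ k q, 0 ≤ Ne k q)
    (hNf : ∀ k ∈ Icc 3 (Fintype.card (HubbardFieldIdx L M × Fin 2) + 2), ∀ q ≤ 4, ∀ σ : Fin q → SectorLeg (sectorCount (n - 2) + 4),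
      hubbardSectorKernelNorm L M β (pointAugment (klAnisoFamily L M β μ K klE0 (n - 2)) (klE5ExtMomenta Qm x y)) (prescribedTuples univ
        (Fin.append (fun _ : Fin k => (none : Option (SectorLeg (sectorCount (n - 2) + 4)))) (fun j => some (σ j))))
        (klE5Carrier L M β μ K (n - 1) (klE5Kappa L M β U μ K (n - 1)) (klE5Input L M β U μ K (n - 1)) Λ) ≤ Nf k q)
    (hNe : ∀ k ∈ Icc 3 (Fintype.card (HubbardFieldIdx L M × Fin 2) + 2), ∀ q ≤ 4,
      ∀ (τ : Fin 3 → SectorLeg (sectorCount (n - 2) + 4)) (σ : Fin q → SectorLeg (sectorCount (n - 2) + 4)),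
      hubbardSectorKernelNorm L M β (pointAugment (klAnisoFamily L M β μ K klE0 (n - 2)) (klE5ExtMomenta Qm x y)) (prescribedTuples univ
        (Fin.append (fun i : Fin k => if h : (i : ℕ) < 3 then some (τ ⟨i, h⟩) else none) (fun j => some (σ j))))
        (klE5Carrier L M β μ K (n - 1) (klE5Kappa L M β U μ K (n - 1)) (klE5Input L M β U μ K (n - 1)) Λ) ≤ Ne k q)
    {x' A : ℝ} (hx0 : 0 ≤ x') (hx1 : x' ≤ 1 / 2) (hA : 0 ≤ A)
    (henv : ∀ q ∈ Icc 1 4, ∀ k ∈ Icc 3 (Fintype.card (HubbardFieldIdx L M × Fin 2) + 2),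
      (κ₀ ^ 2 + κ₁ ^ 2) ^ (k - 3) * ((imagTimeWeight β M * Nf k q) * (imagTimeWeight β M * Ne k (4 - q))) ≤ x' ^ (k - 3) * A)
    {Cα Cδ CA Klam : ℝ}
    (hαs : α ≤ (klScale klE0 (n - 1) - klScale klE0 n) * (Cα * (imagTimeWeight β M)⁻¹ * (16 : ℝ) ^ n / klE0 ^ 2))
    (hδs : δ ≤ Cδ * klE0 * ((8 : ℝ) ^ n)⁻¹) (hAs : A ≤ CA * imagTimeWeight β M ^ 2 * (Klam * U) ^ 3 * (8 : ℝ) ^ n) :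
    ‖klE5BlockR1 L M β U μ K (n - 1) Λ Qm x y‖ * (klScale klE0 (n - 1) - klScale klE0 n) ≤
      ((((4 : ℕ).factorial : ℝ) * 13 ^ 4 * (1680 * 2 ^ 9) * 88 ^ 2 * 3 * (16 * Cα) * Cδ ^ 2 * CA) * klE0) * (Klam * U) ^ 3 * ((2 : ℝ) ^ n)⁻¹ := by
  have h := klE5Block_slice_le_of_stepData_klAniso β μ K (klE5Kappa L M β U μ K (n - 1)) (klE5Input L M β U μ K (n - 1)) Λ Qm x y hβ hn hΛ
    hα hκ₀ hδ hκ₁ hrow hcol hκF₀ hκG₀ hent hκF₁ hκG₁ Nf Ne hNe0 hNf hNe hx0 hx1 hA henv hαs hδs hAs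
  unfold klE5BlockR1
  refine h.trans (le_of_eq ?_)
  ring

end R1

end Summit.HubbardSuperconductivity.HubbardSuperconductivity.Theorems.KLRegimeSplit

end
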